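import Mathlib
import Summits.Ventures.HodgeRepro.Tier4.Line1.SpectralOfRTF
import Summits.Ventures.HodgeRepro.Tier4.Line1.IrreducibleSubspace
import Summits.Ventures.HodgeRepro.Tier4.Line1.BlockSimple
import Summits.Ventures.HodgeRepro.Tier4.Line1.IsotypicBlock

/-!
# Tier4/Line1/IsolatedConstituentNonzero — (C-NZ): THE CONSTITUENT WITH A NON-ZERO SPECTRAL BLOCK MEETS THE TYPE-σ BLOCK
NON-TRIVIALLY — a theorem, not data

Blind re-derivation cell `pub-hodge-repro`, Tier 4 (README §9–§10), seat t4-L1-p1 (gen 3); plan-1's cut (C-NZ) S14335.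
Target tree path `lean/Summits/Ventures/HodgeRepro/Tier4/Line1/IsolatedConstituentNonzero.lean`.  Imports this seat's
`SpectralOfRTF` (`specBlock`, `exists_specTerm_ne_zero_of_specBlock_ne_zero`) and `IrreducibleSubspace` (`R_invariant`,
`continuous_R_of_invariant`), t4-L1-p2's `BlockSimple` (`R_R_eq_R_conv`: `R f' (R f ψ) = R (f' ⋆ f) ψ`), t4-L1-p3's
`IsotypicBlock` (`isotypicFixed`, `mem_isotypicFixed`) and through it `IsotypicIdempotent` (`eσ`, `isTest_eσ`,
`charExt`, `measure_toReal_ne_zero`).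

WHAT THIS IS.  p5's `IdempotentData` / p3's `IdempotentData.ofIsotypic` display, for the constituent `τ m` carrying the
period, that the type-σ block `Vb = isotypicFixed S K ρ` meets `τ m` non-trivially (`hne : ∃ w ∈ W i₀, w ≠ 0`).  This
follows from the non-zero spectral block of any test pair whose first test's reflection is left-fixed by `eσ`:
a non-zero `m`-block has a term `j` with `n j = m` and `ℓ_χ(R(f̄₁) φ_j) ≠ 0`, so `ψ := R(f̄₁) φ_j ≠ 0`; `ψ ∈ τ m`
(`IsInvariantSubspace.conv`), `ψ` is invariant and continuous, and `R(eσ) ψ = R(eσ ⋆ f̄₁) φ_j = ψ` by `R_R_eq_R_conv` and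
`hleft : eσ ⋆ f̄₁ = f̄₁` — so `ψ ∈ isotypicFixed` (`exists_ne_zero_isotypicFixed_of_specBlock_ne_zero`).  SPHERICAL
COROLLARY (`ρ = 1`, `d = 1`): `eσ S K 1 = μ(K)⁻¹ · 1_K` and `eσ ⋆ f = f` for every LEFT-`K`-invariant `f`
(`conv_eσ_one_of_left_invariant`: the substitution is trivial, `f (h⁻¹ g) = f g` on `K`, the volume cancels), so for a
left-`K`-invariant `f₁` the hypothesis `hleft` is a theorem (`exists_ne_zero_isotypicFixed_of_specBlock_ne_zero_spherical`).
NOT asked (plan-1 S14335): which `m` is isolated ((S3″)'s `hiso`, the geometric side) or `specBlock ≠ 0` itself (the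
Rallis non-vanishing — DATA / print).  0 print.  Nothing here says anything about the status of the Hodge conjecture for
CM abelian varieties, which is NOT proved (HC_CM is NOT proved by anyone in this repository).
-/

set_option autoImplicit false

noncomputable section

namespace Summit.Ventures.HodgeRepro.Tier4.Line1

open MeasureTheory Topology

namespace RTF

namespace Setting

variable {G : Type} [Group G] [TopologicalSpace G] [IsTopologicalGroup G] [MeasurableSpace G] [BorelSpace G]
  (S : Setting G) (K : Subgroup G) {d : ℕ} (ρ : K →* Matrix (Fin d) (Fin d) ℂ)
  (hKo : IsOpen (K : Set G)) (hKc : IsCompact (K : Set G)) (hρ : Continuous ρ)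

/-- **(C-NZ)**: a non-zero `m`-block of a test pair whose first test's reflection is left-fixed by `eσ` produces a
NON-ZERO vector of `τ m` in the type-σ block `isotypicFixed`. -/
theorem exists_ne_zero_isotypicFixed_of_specBlock_ne_zero [SecondCountableTopology G] [T2Space G] [MeasurableMul G]
    [SFinite S.μ] (χ : S.T → ℂ) (χ' : S.T' → ℂ) {τ : ℕ → Set (G → ℂ)} {φ : ℕ → G → ℂ} {n : ℕ → ℕ}
    (hB : S.IsAdaptedONB τ φ n) {f₁ f₂ : G → ℂ} (hf : IsTest (cj f₁))
    (hleft : S.conv (eσ S K ρ) (cj f₁) = cj f₁) {m : ℕ} (h : specBlock S χ χ' φ n f₁ f₂ m ≠ 0) :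
    ∃ ψ ∈ isotypicFixed S K ρ hKo hKc hρ, ψ ∈ τ m ∧ ψ ≠ 0 := by
  obtain ⟨j, hj, hne⟩ := S.exists_specTerm_ne_zero_of_specBlock_ne_zero χ χ' φ n f₁ f₂ h
  have hP : S.periodT χ (fun t => S.R (cj f₁) (φ j) t) ≠ 0 := by
    intro h0
    apply hne
    unfold specTerm
    rw [h0]
    simp
  have hR : S.R (cj f₁) (φ j) ≠ 0 := by
    intro h0
    apply hP
    unfold periodT
    simp [h0]
  have hφc : Continuous (φ j) := (hB.inv (n j)).cont _ (hB.mem j)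
  have hφi : S.Invariant (φ j) := (hB.inv (n j)).inv _ (hB.mem j)
  have hmem : S.R (cj f₁) (φ j) ∈ τ m := by
    rw [← hj]
    exact (hB.inv (n j)).conv (φ j) (hB.mem j) (cj f₁) hf
  refine ⟨S.R (cj f₁) (φ j), ⟨S.R_invariant _ hφi, S.continuous_R_of_invariant hf hφi hφc, ?_⟩, hmem, hR⟩
  rw [S.R_R_eq_R_conv (isTest_eσ S K ρ hKo hKc hρ) hf hφc, hleft]

section Spherical

omit [IsTopologicalGroup G] [BorelSpace G] in
/-- the spherical idempotent `eσ S K 1` (`d = 1`, `ρ = 1`) is `μ(K)⁻¹` on `K`. -/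
theorem eσ_one_of_mem {g : G} (hg : g ∈ K) :
    eσ S K (1 : K →* Matrix (Fin 1) (Fin 1) ℂ) g = ((((S.μ (K : Set G)).toReal)⁻¹ : ℝ) : ℂ) := by
  unfold eσ charExt repExt
  simp [hg, Matrix.trace]

omit [IsTopologicalGroup G] [BorelSpace G] in
/-- the spherical idempotent `eσ S K 1` is `0` off `K`. -/
theorem eσ_one_of_not_mem {g : G} (hg : g ∉ K) : eσ S K (1 : K →* Matrix (Fin 1) (Fin 1) ℂ) g = 0 := by
  unfold eσ charExt repExt
  simp [hg]

omit [IsTopologicalGroup G] in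
include hKo hKc in
/-- **the spherical idempotent fixes every left-`K`-invariant function under convolution**:
`eσ S K 1 ⋆ f = f` (the volume of `K` cancels). -/
theorem conv_eσ_one_of_left_invariant {f : G → ℂ} (hf : ∀ k ∈ K, ∀ g, f (k * g) = f g) :
    S.conv (eσ S K (1 : K →* Matrix (Fin 1) (Fin 1) ℂ)) f = f := by
  haveI := S.haar
  funext g
  unfold conv
  have hK : MeasurableSet (K : Set G) := hKo.measurableSet
  have h1 : (fun h => eσ S K (1 : K →* Matrix (Fin 1) (Fin 1) ℂ) h * f (h⁻¹ * g)) =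
      (K : Set G).indicator fun _ => ((((S.μ (K : Set G)).toReal)⁻¹ : ℝ) : ℂ) * f g := by
    funext h
    by_cases hh : h ∈ K
    · rw [S.eσ_one_of_mem K hh, Set.indicator_of_mem hh, hf h⁻¹ (K.inv_mem hh) g]
    · rw [S.eσ_one_of_not_mem K hh, Set.indicator_of_notMem hh, zero_mul]
  rw [h1, integral_indicator hK, setIntegral_const, measureReal_def, Complex.real_smul]
  have hne : (S.μ (K : Set G)).toReal ≠ 0 := S.measure_toReal_ne_zero K hKo hKc
  have : ((S.μ (K : Set G)).toReal : ℂ) * ((((S.μ (K : Set G)).toReal)⁻¹ : ℝ) : ℂ) = 1 := by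
    rw [← Complex.ofReal_mul, mul_inv_cancel₀ hne, Complex.ofReal_one]
  rw [← mul_assoc, this, one_mul]

/-- **(C-NZ), SPHERICAL**: for a LEFT-`K`-invariant `f₁` the hypothesis `hleft` is a theorem and a non-zero `m`-block
produces a non-zero vector of `τ m` in the spherical block `isotypicFixed S K 1`. -/
theorem exists_ne_zero_isotypicFixed_of_specBlock_ne_zero_spherical [SecondCountableTopology G] [T2Space G]
    [MeasurableMul G] [SFinite S.μ] (hρ₁ : Continuous (1 : K →* Matrix (Fin 1) (Fin 1) ℂ)) (χ : S.T → ℂ)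
    (χ' : S.T' → ℂ) {τ : ℕ → Set (G → ℂ)} {φ : ℕ → G → ℂ} {n : ℕ → ℕ} (hB : S.IsAdaptedONB τ φ n) {f₁ f₂ : G → ℂ}
    (h₁ : IsTest f₁) (hf₁ : ∀ k ∈ K, ∀ g, f₁ (k * g) = f₁ g) {m : ℕ} (h : specBlock S χ χ' φ n f₁ f₂ m ≠ 0) :
    ∃ ψ ∈ isotypicFixed S K (1 : K →* Matrix (Fin 1) (Fin 1) ℂ) hKo hKc hρ₁, ψ ∈ τ m ∧ ψ ≠ 0 :=
  S.exists_ne_zero_isotypicFixed_of_specBlock_ne_zero K (1 : K →* Matrix (Fin 1) (Fin 1) ℂ) hKo hKc hρ₁ χ χ' hB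
    h₁.cj (S.conv_eσ_one_of_left_invariant K hKo hKc (cj_left_invariant K hf₁)) h

end Spherical

end Setting

end RTF

end Summit.Ventures.HodgeRepro.Tier4.Line1

end
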